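import Summits.BirchSwinnertonDyer.BirchSwinnertonDyer.Theorems.SignedLowerHalvesSmallImageLowerHalfBothSignsRttJunctionShaLayerSha
import Summits.BirchSwinnertonDyer.BirchSwinnertonDyer.Theorems.SignedLowerHalvesSmallImageLowerHalfBothSignsRttD2SeqJ3HS2
import Literature.NumberTheory.GaloisCohomology.PoitouTateShaRestrictedLayers
import HarnessLib

/-!
# Route `SignedLowerHalves`, crux L `SmallImageLowerHalfBothSigns` (stmt-BirchSwinnertonDyer-23599), line `rtt_w3` v32 — stub S3α″ (`stub_junctionShaPi_ns`),
# brick α5′-1: THE LAYER POITOU–TATE PAIRING `⟨·,·⟩_{n,k} : Ш²_P(K_n, 𝒪 ⊗ μ_{p^k} ⊗ θ′) × Ш¹_P(K_n, A[p^k]) → ℚ/ℤ` IN honda's CURRENCY, PERFECT — for an ABSTRACT discrete module `A`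

INPUTS hand `bsd-inputs-honda-p1` g29 under LEAD `cruxlead-stmt-BirchSwinnertonDyer-23599` (cell `bsd-ssimc`); helper `--supports stmt-BirchSwinnertonDyer-23599`.
DEFINITIONS WITH BODIES (`shaPairingO`, `eTwoO`, `eOneO`, `pairO`) + THEOREMS; no named fact (the base-field Poitou–Tate fact is a displayed HYPOTHESIS `hPT`, a THEOREM for totally
complex `K`: `EisensteinPrimesPoitouTateShaNaturalAtTC.forall_poitouTate_shaRestricted_tateDual_natural_at_of_isTotallyComplex`), no instance, no `sorry`.
The one-variable `𝒪`-coefficient twin of the tree's IMC template `Literature/…/EllipticUnits/ImaginaryQuadraticMainConjectureLayerDualityPairing.lean` (JLK 2011 Lemma 5.8, class-group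
row): there `μ_{p^k} ⊗ θ′` pairs with `(ℤ/p^k)(θ)`; here honda's `X_k = 𝒪 ⊗ μ_{p^k} ⊗ θ′` (`muTwistO S θ′ k`) pairs with the torsion levels `A[p^k]` (-w3's `torsRep A hstab p k`) of an ABSTRACT
discrete `p`-primary `Γ_K`-module `A` through an abstract family of equivariant pairings `B k : X_k × A[p^k] → μ_{p^k}` (binder `hB`), PERFECT on the right (binder `hperf`) — the pattern of
-w3's generic J3 files; the instantiation `A := Cofree θ F`, `B := cofreeLamPairing S K λ hλ θ` (`θ′θ = 1`, `λ` perfect: `exists_lam_perfect`) is a one-theorem sequel, so that no file of the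
chain elaborates the heavy `Cofree` types more than once.

* §1 `oMuCarrier_torsion`, `mem_of_natCard_oMuCarrier_mem` (the order of `X_k` is a unit outside `P ∋ (v ∣ p)`), `ramificationSubgroup_le_ker_muTwistO`, `ramificationSubgroup_le_ker_torsRep`,
  `isUnramifiedOutside_muTwistO_coind` — the hypotheses of clause (P_V) of the engine in honda's setting;
* §2 `shaPairingO n k` — the engine `PoitouTateShaRestrictedLayers.exists_shaRestricted_pairing_coind_of_natural_at P hPT` at `(X_k, A[p^k], B k, U_n)`; `shaPairingO_bijective`,
  `finite_shaRestricted_coind` ((P_V));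
* §3 ★★ `pairO n k : ShaLayer.layerShaRestricted P (muTwistO S θ′ k) (U_n) 2 →+ (ShaLayer.layerShaRestricted P (torsRep A hstab p k) (U_n) 1 →+ ℚ/ℤ)` — transport along
  `ShaLayer.shaRestrictedCoindLayerEquiv_two/_one` (so the `Ш²`-side IS an additive subgroup of honda's layer group `cycLayerCohO S κ θ′ P n k 2`, g28 p817363), `pairO_apply`,
  ★★ `pairO_bijective`, `pairO_flip_bijective`, `finite_layerShaRestricted`.
Naturality (`pairO_cores/_red/_conj`), the `Ш¹`-side maps to the strict Selmer group, the `Λ`-linear `π` and the gluing are the sequel bricks α5′-2…5.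
HONEST FRAMING: bookkeeping over the tree's Poitou–Tate engine; α5′, S3α″, crux L and BSD are NOT proved here and remain OPEN; BSD is proved for NO curve.
References: [MilneADT2006] I Thm. 4.10 (a) (p. 57), §0 Cor. 2.3; [Harari2020] Thm. 17.13 (b); [NeukirchSchmidtWingberg2008] (7.2.6), (8.6.7); [Rubin2000] §4.2;
[JohnsonLeungKings2011] §5.4 Lemma 5.8.
-/

set_option autoImplicit false
set_option linter.dupNamespace false -- D-0017: single-problem summit, the namespace repeats the problem name by design
noncomputable section

open scoped Classical
open NumberField IsDedekindDomain Field Function CategoryTheory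

namespace Summit.BirchSwinnertonDyer.BirchSwinnertonDyer.Theorems.SmallImageRttJunctionSha

open Literature.NumberTheory.EllipticCurves Literature.NumberTheory.GaloisRepresentations
  Literature.NumberTheory.GaloisRepresentations.DiscreteGaloisModule Literature.NumberTheory.GaloisCohomology Literature.NumberTheory.GaloisCohomology.ShaLayer
  Literature.NumberTheory.ComplexMultiplication.EllipticUnits Literature.NumberTheory.ComplexMultiplication.EllipticUnits.JohnsonLeungKings2011
  Summit.BirchSwinnertonDyer.BirchSwinnertonDyer.Theorems.SmallImageRttD2J1 Summit.BirchSwinnertonDyer.BirchSwinnertonDyer.Theorems.SmallImageRttD2Seq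

/-! ## §1 The hypotheses of (P_V) in honda's setting -/

section Hyp

variable {K : Type} [Field K] [NumberField K] {p : ℕ} [Fact p.Prime] (S : Set (PadicAlgCl p))
  (θ' : absoluteGaloisGroup K →ₜ* (padicCoeffIntegers S)ˣ) (P : Set (HeightOneSpectrum (𝓞 K)))

omit [NumberField K] in
/-- **`X_k = 𝒪 ⊗ μ_{p^k}` is killed by `p^k`.** [cite: MilneADT2006, I Thm. 4.10 (a) (p. 57)] -/
theorem oMuCarrier_torsion (k : ℕ) (m : OMuCarrier K S (p ^ k)) : p ^ k • m = 0 := by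
  rw [← natCast_zsmul, Nat.cast_pow]
  exact OMuCarrier.pow_smul_eq_zero S k m

omit [NumberField K] in
/-- **"The order of `X_k` is a unit outside `P`"**: `#(𝒪 ⊗ μ_{p^k})` is a power of `p` (a finite group killed by `p^k`), so a finite place dividing it lies above `p`, hence in `P`
once every place above `p` does. [cite: MilneADT2006, I Thm. 4.10 (a) (p. 57)] -/
theorem mem_of_natCard_oMuCarrier_mem [FiniteDimensional ℚ_[p] (padicCoeffField S)] (hpP : ∀ v : HeightOneSpectrum (𝓞 K), ((p : ℕ) : 𝓞 K) ∈ v.asIdeal → v ∈ P) (k : ℕ)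
    (v : HeightOneSpectrum (𝓞 K)) (hv : ((Nat.card (OMuCarrier K S (p ^ k)) : ℕ) : 𝓞 K) ∈ v.asIdeal) : v ∈ P := by
  haveI := finite_oMuCarrier (K := K) S k
  -- a finite additive group killed by `p^k` is a `p`-group
  have hpg : IsPGroup p (Multiplicative (OMuCarrier K S (p ^ k))) := fun g ↦
    ⟨k, by rw [← ofAdd_toAdd g, ← ofAdd_nsmul, oMuCarrier_torsion S k, ofAdd_zero]⟩
  obtain ⟨m, hm⟩ := IsPGroup.iff_card.mp hpg
  have hcard : Nat.card (OMuCarrier K S (p ^ k)) = p ^ m := by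
    rw [← hm]; exact Nat.card_congr Multiplicative.ofAdd
  rw [hcard, Nat.cast_pow] at hv
  rcases Nat.eq_zero_or_pos m with h0 | -
  · rw [h0, pow_zero] at hv
    exact absurd (v.asIdeal.eq_top_of_isUnit_mem hv isUnit_one) v.isPrime.ne_top
  · exact hpP v (v.isPrime.mem_of_pow_mem _ hv)

/-- **`N_P` acts trivially on `X_k = 𝒪 ⊗ μ_{p^k} ⊗ θ′`** (`θ′|_{N_P} = 1`, and `N_P` fixes `μ_{p^∞}` when every place above `p` lies in `P`: -w3's
`mu_apply_eq_self_of_mem_ramificationSubgroup` + `mem_invariants_muTwistO_of_forall`). [cite: NeukirchSchmidtWingberg2008, (7.2.6)] [cite: Kato2004Asterisque, §17.13] -/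
theorem ramificationSubgroup_le_ker_muTwistO (hθN : ∀ g ∈ ramificationSubgroup K P, θ' g = 1)
    (hPp : ∀ w : HeightOneSpectrum (𝓞 K), w ∉ P → ((p : ℕ) : 𝓞 K) ∉ w.asIdeal) (k : ℕ) :
    ramificationSubgroup K P ≤ ContinuousRep.ker (muTwistO S θ' k) := by
  intro g hg
  rw [ContinuousRep.ker, MonoidHom.mem_ker]
  refine LinearMap.ext fun x ↦ ?_
  have hx := mem_invariants_muTwistO_of_forall S θ' P k hθN (fun g hg ζ ↦ mu_apply_eq_self_of_mem_ramificationSubgroup P hPp k hg ζ) x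
  rw [Representation.mem_invariants] at hx
  exact hx ⟨g, hg⟩

omit [NumberField K] [Fact p.Prime] in
/-- **`N_P` acts trivially on `A[p^k]`** when it acts trivially on `A` (`A` unramified outside `P`; for `A = Cofree θ F` the frame's (U) with `θ′θ = 1`:
-w3's `forall_smul_cofree_eq_of_frameSupp`). [cite: Greenberg1989, §1] -/
theorem ramificationSubgroup_le_ker_torsRep (M : Type) [AddCommGroup M] [DistribMulAction (absoluteGaloisGroup K) M] [TopologicalSpace M] [DiscreteTopology M]
    (hstab : ∀ m : M, IsOpen (MulAction.stabilizer (absoluteGaloisGroup K) m : Set (absoluteGaloisGroup K)))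
    (hMP : ∀ τ ∈ ramificationSubgroup K P, ∀ m : M, τ • m = m) (k : ℕ) :
    ramificationSubgroup K P ≤ ContinuousRep.ker (torsRep M hstab p k) := by
  intro g hg
  rw [ContinuousRep.ker, MonoidHom.mem_ker]
  refine LinearMap.ext fun m ↦ Subtype.ext ?_
  change ((g • m : ↥(torsionPow M p k)) : M) = m
  exact hMP g hg m

omit [NumberField K] [Fact p.Prime] in
/-- The torsion level `A[p^k]` is killed by `p^k`. [folklore] -/
theorem torsionPow_nsmul_eq_zero (M : Type) [AddCommGroup M] (k : ℕ) (m : ↥(torsionPow M p k)) : p ^ k • m = 0 :=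
  Subtype.ext (by rw [AddSubgroupClass.coe_nsmul]; exact (mem_torsionPow_iff (M := M) (p := p) k (m : M)).mp m.2)

end Hyp

/-! ## §2 The engine's pairing at `(X_k, A[p^k], B k, U_n)` and its perfectness -/

section Engine

variable {K : Type} [Field K] [NumberField K] {p : ℕ} [Fact p.Prime] (S : Set (PadicAlgCl p)) [FiniteDimensional ℚ_[p] (padicCoeffField S)]
  (κ : ZpExtension K p) (θ' : absoluteGaloisGroup K →ₜ* (padicCoeffIntegers S)ˣ) (P : Set (HeightOneSpectrum (𝓞 K)))
  (M : Type) [AddCommGroup M] [DistribMulAction (absoluteGaloisGroup K) M] [TopologicalSpace M] [DiscreteTopology M]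
  (hstab : ∀ m : M, IsOpen (MulAction.stabilizer (absoluteGaloisGroup K) m : Set (absoluteGaloisGroup K)))
  (B : ∀ k : ℕ, OMuCarrier K S (p ^ k) →+ ↥(torsionPow M p k) →+ MuCarrier K (p ^ k))
  (hB : ∀ (k : ℕ) (σ : absoluteGaloisGroup K) (x : OMuCarrier K S (p ^ k)) (m : ↥(torsionPow M p k)),
    B k (muTwistO S θ' k σ x) (torsRep M hstab p k σ m) = mu K (p ^ k) σ (B k x m))
  (hPT : poitouTate_shaRestricted_tateDual_natural_at K P)
  [hFin : ∀ n : ℕ, Fintype (absoluteGaloisGroup K ⧸ κ.layerSubgroup n)]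

include hB hPT in
/-- **The Poitou–Tate pairing of the layer `(n, k)` in `Ш`-currency**: the engine's `P` (from the base-field fact `hPT`) at `X_k = 𝒪 ⊗ μ_{p^k} ⊗ θ′`, `A[p^k]`, `B k`,
`V = U_n = Gal(K̄/K_n)`: `Ш²_P(K, Ind_{U_n} X_k) × Ш¹_P(K, Ind_{U_n} A[p^k]) → ℚ/ℤ`. [cite: MilneADT2006, I Thm. 4.10 (a) (p. 57)] [cite: Harari2020, Thm. 17.13 (b)] -/
def shaPairingO (n k : ℕ) :
    ↥(shaRestricted ((muTwistO S θ' k).coind (κ.layerSubgroup n) (κ.isOpen_layerSubgroup n)) P 2) →+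
      ↥(shaRestricted (DiscreteGaloisModule.coind (torsRep M hstab p k) (κ.layerSubgroup n) (κ.isOpen_layerSubgroup n)) P 1) →+ AddCircle (1 : ℚ) :=
  haveI := finite_oMuCarrier (K := K) S k
  Classical.choose (exists_shaRestricted_pairing_coind_of_natural_at P hPT) (p ^ k) (OMuCarrier K S (p ^ k)) (↥(torsionPow M p k)) (muTwistO S θ' k)
    (torsRep M hstab p k) (B k) (hB k) (κ.layerSubgroup n) (κ.isOpen_layerSubgroup n)

variable (hNP : ∀ n : ℕ, ramificationSubgroup K P ≤ κ.layerSubgroup n)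
  (hμ : ∀ k : ℕ, ramificationSubgroup K P ≤ ContinuousRep.ker (muTwistO S θ' k))
  (hA : ∀ k : ℕ, ramificationSubgroup K P ≤ ContinuousRep.ker (torsRep M hstab p k))
  (hpP : ∀ v : HeightOneSpectrum (𝓞 K), ((p : ℕ) : 𝓞 K) ∈ v.asIdeal → v ∈ P)

omit [FiniteDimensional ℚ_[p] (padicCoeffField S)] in
include hNP hμ in
/-- **`Ind_{U_n} X_k` is unramified outside `P`** in the `coind` currency of the engine (the tree's `isUnramifiedOutside_coindOpen` read through the definitional
`coindOpen_eq_coind`, rewritten rather than unfolded). [cite: MilneADT2006, I Thm. 4.10 (a) (p. 57)] [cite: Harari2020, Thm. 17.13 (b)] -/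
theorem isUnramifiedOutside_muTwistO_coind (n k : ℕ) :
    GaloisRep.IsUnramifiedOutside P ((muTwistO S θ' k).coind (κ.layerSubgroup n) (κ.isOpen_layerSubgroup n)) := by
  haveI : (κ.layerSubgroup n).FiniteIndex := Subgroup.finiteIndex_of_finite_quotient
  rw [← coindOpen_eq_coind]
  exact isUnramifiedOutside_coindOpen P (muTwistO S θ' k) (κ.layerSubgroup n) (κ.isOpen_layerSubgroup n) (hNP n) (hμ k)

include hNP hμ hpP in
/-- **PERFECTNESS in `Ш`-currency** ((P_V) of the engine: `p^k ≥ 1`, `X_k` is `p^k`-torsion and finite, `Ind_{U_n} X_k` is unramified outside `P`, `#X_k` is a unit outside `P`,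
and `a ↦ B k (·, a)` is bijective). Instance arguments of the engine are supplied by unification, so that its types match the declared ones syntactically.
[cite: MilneADT2006, I Thm. 4.10 (a) (p. 57)] [cite: Harari2020, Thm. 17.13 (b)] -/
theorem shaPairingO_bijective (n k : ℕ) (hperf : Bijective fun m : ↥(torsionPow M p k) ↦ (B k).flip m) :
    Bijective (shaPairingO S κ θ' P M hstab B hB hPT n k) ∧ Bijective (shaPairingO S κ θ' P M hstab B hB hPT n k).flip := by
  haveI : NeZero (p ^ k) := ⟨pow_ne_zero k (Fact.out : p.Prime).ne_zero⟩
  haveI := finite_oMuCarrier (K := K) S k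
  have h0 := (Classical.choose_spec (exists_shaRestricted_pairing_coind_of_natural_at P hPT)).1
  have h := @h0 (p ^ k) _ (OMuCarrier K S (p ^ k)) (↥(torsionPow M p k)) (_) (_) _ _ (_) (_) _ (muTwistO S θ' k) (torsRep M hstab p k) (B k) (hB k)
    (κ.layerSubgroup n) (hFin n) (κ.isOpen_layerSubgroup n) hperf (oMuCarrier_torsion S k) (isUnramifiedOutside_muTwistO_coind S κ θ' P hNP hμ n k)
    (mem_of_natCard_oMuCarrier_mem S P hpP k)
  exact ⟨h.2.2.1, h.2.2.2⟩

include B hB hPT hNP hμ hpP in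
/-- **FINITENESS of the two `Ш`'s at the layer** ((P_V) of the engine). [cite: MilneADT2006, I Thm. 4.10 (a) (p. 57)] -/
theorem finite_shaRestricted_coind (n k : ℕ) (hperf : Bijective fun m : ↥(torsionPow M p k) ↦ (B k).flip m) :
    Finite ↥(shaRestricted (DiscreteGaloisModule.coind (torsRep M hstab p k) (κ.layerSubgroup n) (κ.isOpen_layerSubgroup n)) P 1) ∧
      Finite ↥(shaRestricted ((muTwistO S θ' k).coind (κ.layerSubgroup n) (κ.isOpen_layerSubgroup n)) P 2) := by
  haveI : NeZero (p ^ k) := ⟨pow_ne_zero k (Fact.out : p.Prime).ne_zero⟩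
  haveI := finite_oMuCarrier (K := K) S k
  have h0 := (Classical.choose_spec (exists_shaRestricted_pairing_coind_of_natural_at P hPT)).1
  have h := @h0 (p ^ k) _ (OMuCarrier K S (p ^ k)) (↥(torsionPow M p k)) (_) (_) _ _ (_) (_) _ (muTwistO S θ' k) (torsRep M hstab p k) (B k) (hB k)
    (κ.layerSubgroup n) (hFin n) (κ.isOpen_layerSubgroup n) hperf (oMuCarrier_torsion S k) (isUnramifiedOutside_muTwistO_coind S κ θ' P hNP hμ n k)
    (mem_of_natCard_oMuCarrier_mem S P hpP k)
  exact ⟨h.1, h.2.1⟩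

/-! ## §3 The layer pairing in honda's currency -/

omit [FiniteDimensional ℚ_[p] (padicCoeffField S)] in
include hNP hμ in
/-- The Ш-transport for `Ш²_P(K_n, X_k)` onto an additive subgroup of honda's layer group `cycLayerCohO S κ θ′ P n k 2 = H²((U_n)_P, X_k)` (g28 p817363:
`ShaLayer.layerShaRestricted P (muTwistO S θ′ k) (U_n) 2 ≤ cycLayerCohO …`). [cite: MilneADT2006, I §4 (p. 56)] [cite: NeukirchSchmidtWingberg2008, I §6 (1.6.4)] -/
def eTwoO (n k : ℕ) :
    ↥(shaRestricted ((muTwistO S θ' k).coind (κ.layerSubgroup n) (κ.isOpen_layerSubgroup n)) P 2) ≃+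
      ↥(layerShaRestricted P (muTwistO S θ' k) (κ.layerSubgroup n) 2) :=
  shaRestrictedCoindLayerEquiv_two P (muTwistO S θ' k) (κ.layerSubgroup n) (κ.isOpen_layerSubgroup n) (hNP n) (hμ k)

omit [FiniteDimensional ℚ_[p] (padicCoeffField S)] in
include hNP hA in
/-- The Ш-transport for `Ш¹_P(K_n, A[p^k])` (`shaRestrictedCoindLayerEquiv_one` at `U_n`). [cite: MilneADT2006, I §4 (p. 56)] [cite: NeukirchSchmidtWingberg2008, I §6 (1.6.4)] -/
def eOneO (n k : ℕ) :
    ↥(shaRestricted (DiscreteGaloisModule.coind (torsRep M hstab p k) (κ.layerSubgroup n) (κ.isOpen_layerSubgroup n)) P 1) ≃+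
      ↥(layerShaRestricted P (torsRep M hstab p k) (κ.layerSubgroup n) 1) :=
  shaRestrictedCoindLayerEquiv_one P (torsRep M hstab p k) (κ.layerSubgroup n) (κ.isOpen_layerSubgroup n) (hNP n) (hA k)

include B hB hPT hNP hμ hA in
/-- ★★ **THE LAYER PAIRING `pairO n k : Ш²_P(K_n, 𝒪 ⊗ μ_{p^k} ⊗ θ′) →+ (Ш¹_P(K_n, A[p^k]) →+ ℚ/ℤ)`** in honda's currency: `pairO y z = P (e₂⁻¹ y) (e₁⁻¹ z)`.
[cite: MilneADT2006, I Thm. 4.10 (a) (p. 57)] [cite: JohnsonLeungKings2011, §5.4 Lemma 5.8] -/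
def pairO (n k : ℕ) :
    ↥(layerShaRestricted P (muTwistO S θ' k) (κ.layerSubgroup n) 2) →+ (↥(layerShaRestricted P (torsRep M hstab p k) (κ.layerSubgroup n) 1) →+ AddCircle (1 : ℚ)) :=
  ((AddMonoidHom.compHom.flip (eOneO κ P M hstab hNP hA n k).symm.toAddMonoidHom).comp (shaPairingO S κ θ' P M hstab B hB hPT n k)).comp
    (eTwoO S κ θ' P hNP hμ n k).symm.toAddMonoidHom

/-- Values of `pairO`. [cite: MilneADT2006, I Thm. 4.10 (a) (p. 57)] -/
theorem pairO_apply (n k : ℕ) (y : ↥(layerShaRestricted P (muTwistO S θ' k) (κ.layerSubgroup n) 2)) (z : ↥(layerShaRestricted P (torsRep M hstab p k) (κ.layerSubgroup n) 1)) :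
    pairO S κ θ' P M hstab B hB hPT hNP hμ hA n k y z =
      shaPairingO S κ θ' P M hstab B hB hPT n k ((eTwoO S κ θ' P hNP hμ n k).symm y) ((eOneO κ P M hstab hNP hA n k).symm z) := rfl

/-- `pairO` on transported classes: `pairO (e₂ x) (e₁ w) = P x w`. [cite: MilneADT2006, I Thm. 4.10 (a) (p. 57)] -/
theorem pairO_eTwoO_eOneO (n k : ℕ) (x : ↥(shaRestricted ((muTwistO S θ' k).coind (κ.layerSubgroup n) (κ.isOpen_layerSubgroup n)) P 2))
    (w : ↥(shaRestricted (DiscreteGaloisModule.coind (torsRep M hstab p k) (κ.layerSubgroup n) (κ.isOpen_layerSubgroup n)) P 1)) :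
    pairO S κ θ' P M hstab B hB hPT hNP hμ hA n k (eTwoO S κ θ' P hNP hμ n k x) (eOneO κ P M hstab hNP hA n k w) =
      shaPairingO S κ θ' P M hstab B hB hPT n k x w := by
  have hx := (eTwoO S κ θ' P hNP hμ n k).symm_apply_apply x
  have hw := (eOneO κ P M hstab hNP hA n k).symm_apply_apply w
  rw [pairO_apply]
  exact congrArg₂ (fun a b ↦ shaPairingO S κ θ' P M hstab B hB hPT n k a b) hx hw

/-- `pairO` as a composite `χ ↦ χ ∘ e₁⁻¹` ∘ `P` ∘ `e₂⁻¹` (definitional). [cite: MilneADT2006, I Thm. 4.10 (a) (p. 57)] -/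
theorem coe_pairO (n k : ℕ) :
    ⇑(pairO S κ θ' P M hstab B hB hPT hNP hμ hA n k) =
      (AddEquiv.addMonoidHomCongrLeftEquiv (eOneO κ P M hstab hNP hA n k)) ∘ ⇑(shaPairingO S κ θ' P M hstab B hB hPT n k) ∘ ⇑(eTwoO S κ θ' P hNP hμ n k).symm :=
  rfl

/-- `pairO.flip` as a composite `χ ↦ χ ∘ e₂⁻¹` ∘ `P.flip` ∘ `e₁⁻¹`. [cite: MilneADT2006, I Thm. 4.10 (a) (p. 57)] -/
theorem coe_pairO_flip (n k : ℕ) :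
    ⇑(pairO S κ θ' P M hstab B hB hPT hNP hμ hA n k).flip =
      (AddEquiv.addMonoidHomCongrLeftEquiv (eTwoO S κ θ' P hNP hμ n k)) ∘ ⇑(shaPairingO S κ θ' P M hstab B hB hPT n k).flip ∘ ⇑(eOneO κ P M hstab hNP hA n k).symm := by
  funext z
  ext y
  rfl

include hpP in
/-- ★★ **PERFECTNESS of the layer pairing**: `y ↦ pairO y` is a bijection `Ш²_P(K_n, 𝒪 ⊗ μ_{p^k} ⊗ θ′) ≅ Hom(Ш¹_P(K_n, A[p^k]), ℚ/ℤ)` (transport of `shaPairingO_bijective`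
along the two Ш-equivalences). [cite: MilneADT2006, I Thm. 4.10 (a) (p. 57)] [cite: Harari2020, Thm. 17.13 (b)] -/
theorem pairO_bijective (n k : ℕ) (hperf : Bijective fun m : ↥(torsionPow M p k) ↦ (B k).flip m) :
    Bijective (pairO S κ θ' P M hstab B hB hPT hNP hμ hA n k) := by
  obtain ⟨hb, -⟩ := shaPairingO_bijective S κ θ' P M hstab B hB hPT hNP hμ hpP n k hperf
  rw [coe_pairO]
  exact ((AddEquiv.addMonoidHomCongrLeftEquiv (eOneO κ P M hstab hNP hA n k)).bijective.comp hb).comp (eTwoO S κ θ' P hNP hμ n k).symm.bijective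

include hpP in
/-- **Perfectness on the other side**: `z ↦ (y ↦ pairO y z)` is a bijection `Ш¹_P(K_n, A[p^k]) ≅ Hom(Ш²_P(K_n, X_k), ℚ/ℤ)`. [cite: MilneADT2006, I Thm. 4.10 (a) (p. 57)] -/
theorem pairO_flip_bijective (n k : ℕ) (hperf : Bijective fun m : ↥(torsionPow M p k) ↦ (B k).flip m) :
    Bijective (pairO S κ θ' P M hstab B hB hPT hNP hμ hA n k).flip := by
  obtain ⟨-, hbf⟩ := shaPairingO_bijective S κ θ' P M hstab B hB hPT hNP hμ hpP n k hperf
  rw [coe_pairO_flip]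
  exact ((AddEquiv.addMonoidHomCongrLeftEquiv (eTwoO S κ θ' P hNP hμ n k)).bijective.comp hbf).comp (eOneO κ P M hstab hNP hA n k).symm.bijective

include B hB hPT hNP hμ hA hpP in
/-- **FINITENESS** of the two layer `Ш`'s in honda's currency. [cite: MilneADT2006, I Thm. 4.10 (a) (p. 57)] -/
theorem finite_layerShaRestricted (n k : ℕ) (hperf : Bijective fun m : ↥(torsionPow M p k) ↦ (B k).flip m) :
    Finite ↥(layerShaRestricted P (torsRep M hstab p k) (κ.layerSubgroup n) 1) ∧ Finite ↥(layerShaRestricted P (muTwistO S θ' k) (κ.layerSubgroup n) 2) := by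
  obtain ⟨h1, h2⟩ := finite_shaRestricted_coind S κ θ' P M hstab B hB hPT hNP hμ hpP n k hperf
  exact ⟨Finite.of_equiv _ (eOneO κ P M hstab hNP hA n k).toEquiv, Finite.of_equiv _ (eTwoO S κ θ' P hNP hμ n k).toEquiv⟩

end Engine

end Summit.BirchSwinnertonDyer.BirchSwinnertonDyer.Theorems.SmallImageRttJunctionSha

end
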